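import Summits.CriticalPhenomena.CardyFormulaZ2.Theorems.CardyComplexConeEdgePrecompactUFRSEvents

/-!
# Locality of the strand-crossing events `ufrsStrands`: monotonicity, finite dependence, independence
(line `qkz-strip-boundary-arm` of crux `CardyComplexCone.EdgePrecompact`, stmt-CriticalPhenomena-11387;
first support file of the registered sub-goal `ufrs_screenedCollarDecay_rect`, M3 of the UFRS road map)

The decay of the two-scale collar certificate `ufrsCertFar` (`…UFRSEvents.lean`) multiplies the
probabilities of strand-crossing families of NESTED annuli; this needs the events
`ufrsStrands E w z k r R` to be measurable and determined by the edges near the closed annulus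
`A(z; r, R)`. Proved here:

* `ufrsStrands_mono` — monotonicity in the centre and the radii (a strand from the `r`-ball of `z`
  to distance `≥ R` from `z` runs from the `(r + |z - z'|)`-ball of `z'` to distance `≥ R - |z - z'|`);
* `exists_trimmedStretch` — trimming a crossing stretch of a `δ`-Lipschitz sequence to its last
  visit of `(-∞, r]` before its first visit of `[R, ∞)`: all values of the trimmed stretch lie in
  `(r - δ, R + δ)`;
* `determinedBy_ufrsStrands` — **finite dependence**: for `r < R` the event is determined by the
  lattice pairs all of whose points are at distance in `(r - 2δ, R + 2δ)` from `z` (trim every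
  strand, restart it at its first trimmed corner: the successor map reads only the target edge of
  the current corner, `cornerOrbit_add_eq`, and the completed configurations `E.bcBondConfig ω`,
  `(shiftData E w).bcBondConfig ω` read `ω` edge by edge);
* `measurableSet_ufrsStrands`; `real_inter_eq_of_ball_beyond` — independence under `P_{1/2}` of
  an event determined by the pairs inside a ball and an event determined by the pairs beyond a
  larger radius (`bondPercolation_real_inter_of_disjoint`), the form used by the scale
  decomposition.

References: G. Grimmett, *Percolation* (1999), §2.2 (cylinder events, product measure);
S. Smirnov, C. R. Acad. Sci. Paris 333 (2001), §2 (the exploration process).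
-/

namespace Summit.CriticalPhenomena.CardyFormulaZ2.Cruxes.EdgePrecompact.QkzStripBoundaryArm

open MeasureTheory Filter Set Metric
open scoped Topology BigOperators Pointwise
open Literature.Probability.LatticeModels Literature.Probability.Percolation
open Literature.Probability.RandomPlanarGeometry (DobrushinDomain)
open Summit.CriticalPhenomena.CardyFormulaZ2.Theses.CardyComplexCone

noncomputable section

/-! ## Monotonicity in the centre and the radii -/

/-- **Monotonicity of strand families.** Moving the centre from `z` to `z'` and relaxing the radii by
`dist z z'` (inner radius up, outer radius down) enlarges the event: a strand from the `r`-ball of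
`z` to distance `≥ R` from `z` runs from the `r'`-ball of `z'` to distance `≥ R'` from `z'` whenever
`r + dist z z' ≤ r'` and `R' + dist z z' ≤ R`. -/
theorem ufrsStrands_mono {E : DiscreteDobrushin} {w : Site 2} {z z' : ℂ} {k : ℕ} {r R r' R' : ℝ}
    (hr : r + dist z z' ≤ r') (hR : R' + dist z z' ≤ R) :
    ufrsStrands E w z k r R ⊆ ufrsStrands E w z' k r' R' := by
  intro ω hω
  rw [mem_ufrsStrands_iff] at hω ⊢
  obtain ⟨c, i, j, τ, hstr, hdisj⟩ := hω
  refine ⟨c, i, j, τ, fun a => ?_, hdisj⟩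
  obtain ⟨hij, hends, hinner, hsimple⟩ := hstr a
  refine ⟨hij, ?_, hinner, hsimple⟩
  have key : ∀ x : ℂ, (dist x z ≤ r → dist x z' ≤ r') ∧ (R ≤ dist x z → R' ≤ dist x z') := fun x =>
    ⟨fun h => by linarith [dist_triangle x z z'],
      fun h => by linarith [dist_triangle x z' z, dist_comm z z']⟩
  rcases hends with ⟨h1, h2⟩ | ⟨h1, h2⟩
  · exact Or.inl ⟨(key _).1 h1, (key _).2 h2⟩
  · exact Or.inr ⟨(key _).2 h1, (key _).1 h2⟩

/-- Same centre: the event grows when the inner radius grows and the outer radius shrinks. -/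
theorem ufrsStrands_mono_radii {E : DiscreteDobrushin} {w : Site 2} {z : ℂ} {k : ℕ} {r R r' R' : ℝ}
    (hr : r ≤ r') (hR : R' ≤ R) : ufrsStrands E w z k r R ⊆ ufrsStrands E w z k r' R' :=
  ufrsStrands_mono (by rw [dist_self]; linarith) (by rw [dist_self]; linarith)

/-! ## Trimming a crossing stretch -/

/-- **Trimming.** A real sequence with steps of size `≤ δ` which is `≤ r` at time `i` and `≥ R > r`
at a later time `j` has a sub-stretch `[i', j'] ⊆ [i, j]`, `≤ r` at `i'`, `≥ R` at `j'`, all of whose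
values lie in `(r - δ, R + δ)` (first visit of `[R, ∞)`, then last visit of `(-∞, r]` before it). -/
theorem exists_trimmedStretch (g : ℕ → ℝ) {δ r R : ℝ} (hrR : r < R)
    (hstep : ∀ t, |g (t + 1) - g t| ≤ δ) {i j : ℕ} (hij : i ≤ j) (hi : g i ≤ r) (hj : R ≤ g j) :
    ∃ i' j', i ≤ i' ∧ i' ≤ j' ∧ j' ≤ j ∧ g i' ≤ r ∧ R ≤ g j' ∧
      ∀ t, i' ≤ t → t ≤ j' → r - δ < g t ∧ g t < R + δ := by
  classical
  -- first far index
  obtain ⟨j', hij', hj'j, hRj', hbefore⟩ := exists_firstFarIndex g R hij hj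
  -- last near index before it
  set i' := Nat.findGreatest (fun t => g t ≤ r) j' with hi'
  have hi'spec : g i' ≤ r := Nat.findGreatest_spec (P := fun t => g t ≤ r) hij' hi
  have hii' : i ≤ i' := Nat.le_findGreatest hij' hi
  have hi'j' : i' ≤ j' := Nat.findGreatest_le j'
  have hafter : ∀ t, i' < t → t ≤ j' → ¬ g t ≤ r := fun t ht htj =>
    Nat.findGreatest_is_greatest ht htj
  have hne : i' ≠ j' := by
    intro h; rw [h] at hi'spec; linarith
  have hlt : i' < j' := lt_of_le_of_ne hi'j' hne
  refine ⟨i', j', hii', hi'j', hj'j, hi'spec, hRj', fun t hit htj => ⟨?_, ?_⟩⟩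
  · -- lower bound
    rcases Nat.lt_or_ge i' t with h | h
    · have h1 : r < g t := not_le.1 (hafter t h htj)
      linarith [hstep t, abs_nonneg (g (t + 1) - g t)]
    · have ht : t = i' := le_antisymm h hit
      have h1 : r < g (t + 1) := by
        rcases Nat.lt_or_ge (t + 1) j' with h' | h'
        · exact not_le.1 (hafter (t + 1) (by omega) h'.le)
        · have : t + 1 = j' := by omega
          rw [this]; linarith
      have h2 := (abs_le.1 (hstep t)).2
      linarith
  · -- upper bound
    rcases Nat.lt_or_ge t j' with h | h
    · linarith [hbefore t (hii'.trans hit) h, hstep 0, abs_nonneg (g (0 + 1) - g 0)]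
    · have ht : t = j' := le_antisymm htj h
      obtain ⟨t', rfl⟩ : ∃ t', t = t' + 1 := ⟨t - 1, by omega⟩
      have h1 : g t' < R := hbefore t' (by omega) (by omega)
      have h2 := (abs_le.1 (hstep t')).2
      linarith

/-! ## Finite dependence -/

/-- The completed configuration of any Dobrushin datum reads `ω` edge by edge: two configurations
agreeing on a set of pairs `F` have completed configurations agreeing on `F`. -/
theorem bcBondConfig_agree_on (E' : DiscreteDobrushin) {ω ω' : BondConfig (Site 2)}
    {F : Set (Sym2 (Site 2))} (h : ω ∩ F = ω' ∩ F) :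
    ∀ e ∈ F, (e ∈ E'.bcBondConfig ω ↔ e ∈ E'.bcBondConfig ω') := by
  intro e he
  have hωω' : e ∈ ω ↔ e ∈ ω' :=
    ⟨fun h1 => ((Set.ext_iff.1 h e).1 ⟨h1, he⟩).1, fun h1 => ((Set.ext_iff.1 h e).2 ⟨h1, he⟩).1⟩
  simp only [DiscreteDobrushin.mem_bcBondConfig_iff, hωω']

/-- The successor map reads only the target edge: the orbits of a corner under two configurations
agreeing on `F` coincide as long as the target edges met lie in `F`. -/
theorem cornerOrbit_eq_of_agree_on {β β' : BondConfig (Site 2)} {F : Set (Sym2 (Site 2))}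
    (h : ∀ e ∈ F, (e ∈ β ↔ e ∈ β')) (q : Site 2 × Fin 4) {n : ℕ}
    (hpre : ∀ t < n, cTgt (cornerOrbit β q t) ∈ F) : ∀ t ≤ n, cornerOrbit β' q t = cornerOrbit β q t := by
  intro t ht
  induction t with
  | zero => rfl
  | succ t ih =>
    have ih' := ih (by omega)
    show nextCorner β' (cornerOrbit β' q t) = nextCorner β (cornerOrbit β q t)
    rw [ih']
    have hagree := h _ (hpre t (by omega))
    by_cases hm : cTgt (cornerOrbit β q t) ∈ β
    · rw [nextCorner_of_mem hm, nextCorner_of_mem (hagree.1 hm)]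
    · rw [nextCorner_of_not_mem hm, nextCorner_of_not_mem fun h' => hm (hagree.2 h')]

/-- Both endpoints of the target edge of a corner are within one mesh of its vertex. -/
theorem dist_le_of_mem_cTgt {δ : ℝ} (hδ : 0 ≤ δ) (p : Site 2 × Fin 4) {x : Site 2} (hx : x ∈ cTgt p) :
    dist (meshPoint δ x) (meshPoint δ p.1) ≤ δ := by
  rw [cTgt, Sym2.mem_iff] at hx
  rcases hx with rfl | rfl
  · rw [dist_self]; exact hδ
  · rw [dist_meshPoint_add_cornerUnit_eq, abs_of_nonneg hδ]

/-- **Finite dependence of the strand families.** For `r < R` the event `ufrsStrands E w z k r R`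
is determined by the pairs all of whose points are at distance in `(r - 2δ, R + 2δ)` from `z`:
every strand can be trimmed to its last visit of the `r`-ball before its first exit to distance
`≥ R` (`exists_trimmedStretch`) and restarted at its first trimmed corner (`cornerOrbit_add_eq`);
the trimmed, restarted strands only read target edges at corners of the thickened annulus, on which
the two configurations — hence their completed configurations, for both dynamics — agree. -/
theorem determinedBy_ufrsStrands : ∀ (E : DiscreteDobrushin) (w : Site 2) (z : ℂ) (k : ℕ) (r R : ℝ), 0 < E.δ → r < R → DeterminedBy (ufrsStrands E w z k r R) {e : Sym2 (Site 2) | ∀ x ∈ e, r - 2 * E.δ < dist (meshPoint E.δ x) z ∧ dist (meshPoint E.δ x) z < R + 2 * E.δ} := by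
  intro E w z k r R hδ hrR
  set F : Set (Sym2 (Site 2)) := {e | ∀ x ∈ e, r - 2 * E.δ < dist (meshPoint E.δ x) z ∧
    dist (meshPoint E.δ x) z < R + 2 * E.δ} with hF
  rw [determinedBy_iff]
  suffices key : ∀ ω ω' : BondConfig (Site 2), ω ∩ F = ω' ∩ F →
      ω ∈ ufrsStrands E w z k r R → ω' ∈ ufrsStrands E w z k r R from
    fun ω ω' h => ⟨key ω ω' h, key ω' ω h.symm⟩
  intro ω ω' hagree hω
  -- the two dynamics, uniformly in the tag
  set βf : Bool → BondConfig (Site 2) → BondConfig (Site 2) := fun b ω₁ =>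
    if b then E.bcBondConfig ω₁ else (shiftData E w).bcBondConfig ω₁ with hβf
  have fold : ∀ (b : Bool) (ω₁ : BondConfig (Site 2)),
      (if b then E.bcBondConfig ω₁ else (shiftData E w).bcBondConfig ω₁) = βf b ω₁ := fun _ _ => rfl
  have hβagree : ∀ b, ∀ e ∈ F, (e ∈ βf b ω ↔ e ∈ βf b ω') := by
    intro b
    cases b
    · exact bcBondConfig_agree_on (shiftData E w) hagree
    · exact bcBondConfig_agree_on E hagree
  rw [mem_ufrsStrands_iff] at hω ⊢
  simp only [fold] at hω ⊢
  obtain ⟨c, i, j, τ, hstr, hdisj⟩ := hω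
  -- the distance sequence of strand `a`
  set g : Fin k → ℕ → ℝ := fun a t => dist (meshPoint E.δ (cornerOrbit (βf (τ a) ω) (c a) t).1) z with hg
  have hgstep : ∀ a t, |g a (t + 1) - g a t| ≤ E.δ := by
    intro a t
    have h1 := dist_meshPoint_cornerOrbit_succ_le (βf (τ a) ω) (c a) E.δ t
    rw [abs_of_pos hδ] at h1
    exact (abs_dist_sub_le _ _ z).trans h1
  -- trimming each strand
  have htrim : ∀ a, ∃ i' j', i a ≤ i' ∧ i' ≤ j' ∧ j' ≤ j a ∧
      ((g a i' ≤ r ∧ R ≤ g a j') ∨ (R ≤ g a i' ∧ g a j' ≤ r)) ∧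
      ∀ t, i' ≤ t → t ≤ j' → r - E.δ < g a t ∧ g a t < R + E.δ := by
    intro a
    obtain ⟨hij, hends, -, -⟩ := hstr a
    rcases hends with ⟨h1, h2⟩ | ⟨h1, h2⟩
    · obtain ⟨i', j', h3, h4, h5, h6, h7, h8⟩ := exists_trimmedStretch (g a) hrR (hgstep a) hij h1 h2
      exact ⟨i', j', h3, h4, h5, Or.inl ⟨h6, h7⟩, h8⟩
    · -- apply the trimming to the reflected sequence `r + R - g`
      obtain ⟨i', j', h3, h4, h5, h6, h7, h8⟩ := exists_trimmedStretch (fun t => r + R - g a t) hrR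
        (fun t => by
          rw [show r + R - g a (t + 1) - (r + R - g a t) = -(g a (t + 1) - g a t) by ring, abs_neg]
          exact hgstep a t)
        hij (show r + R - g a (i a) ≤ r by linarith) (show R ≤ r + R - g a (j a) by linarith)
      refine ⟨i', j', h3, h4, h5, Or.inr ⟨by linarith, by linarith⟩, fun t ht htj => ?_⟩
      obtain ⟨h9, h10⟩ := h8 t ht htj
      exact ⟨by linarith, by linarith⟩
  choose i' j' hii' hi'j' hj'j hends' hann using htrim
  -- the restarted strands follow the old ones
  have htgt : ∀ a t, i' a ≤ t → t ≤ j' a → cTgt (cornerOrbit (βf (τ a) ω) (c a) t) ∈ F := by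
    intro a t ht htj x hx
    have h1 := dist_le_of_mem_cTgt hδ.le (cornerOrbit (βf (τ a) ω) (c a) t) hx
    obtain ⟨h2, h3⟩ := hann a t ht htj
    have h4 := dist_triangle (meshPoint E.δ x) (meshPoint E.δ (cornerOrbit (βf (τ a) ω) (c a) t).1) z
    have h5 := dist_triangle (meshPoint E.δ (cornerOrbit (βf (τ a) ω) (c a) t).1) (meshPoint E.δ x) z
    rw [dist_comm] at h1
    have h1' := dist_le_of_mem_cTgt hδ.le (cornerOrbit (βf (τ a) ω) (c a) t) hx
    change dist (meshPoint E.δ (cornerOrbit (βf (τ a) ω) (c a) t).1) z < R + E.δ at h3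
    change r - E.δ < dist (meshPoint E.δ (cornerOrbit (βf (τ a) ω) (c a) t).1) z at h2
    constructor <;> linarith
  have horb : ∀ a, ∀ t ≤ j' a - i' a, cornerOrbit (βf (τ a) ω') (cornerOrbit (βf (τ a) ω) (c a) (i' a)) t =
      cornerOrbit (βf (τ a) ω) (c a) (i' a + t) := by
    intro a t ht
    rw [cornerOrbit_add_eq]
    refine cornerOrbit_eq_of_agree_on (hβagree (τ a)) _ (n := j' a - i' a) (fun s hs => ?_) t ht
    rw [← cornerOrbit_add_eq]
    exact htgt a (i' a + s) (by omega) (by omega)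
  -- the new witness
  refine ⟨fun a => cornerOrbit (βf (τ a) ω) (c a) (i' a), fun _ => 0, fun a => j' a - i' a, τ,
    fun a => ⟨Nat.zero_le _, ?_, fun t _ ht => ?_, fun s t _ hst ht => ?_⟩, ?_⟩
  · -- ends
    rw [horb a 0 (Nat.zero_le _), horb a (j' a - i' a) le_rfl, add_zero,
      Nat.add_sub_cancel' (hi'j' a)]
    exact hends' a
  · -- inner faces
    have ht' : t ≤ j' a - i' a := ht
    rw [horb a t ht']
    obtain ⟨-, -, hinner, -⟩ := hstr a
    exact hinner (i' a + t) (by linarith [hii' a]) (by have := hj'j a; have := hi'j' a; omega)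
  · -- simplicity of each strand
    have ht' : t ≤ j' a - i' a := ht
    rw [horb a s (by omega), horb a t ht']
    obtain ⟨-, -, -, hsimple⟩ := hstr a
    exact hsimple (i' a + s) (i' a + t) (by linarith [hii' a]) (by omega) (by have := hj'j a; omega)
  · -- disjointness of different strands
    intro a b hab s t _ hs _ ht
    have hs' : s ≤ j' a - i' a := hs
    have ht' : t ≤ j' b - i' b := ht
    rw [horb a s hs', horb b t ht']
    exact hdisj a b hab (i' a + s) (i' b + t) (by linarith [hii' a])
      (by have := hj'j a; have := hi'j' a; omega) (by linarith [hii' b])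
      (by have := hj'j b; have := hi'j' b; omega)

/-! ## Measurability -/

/-- The pairs of lattice points all of whose points are within distance `T` of `z` form a finite set. -/
theorem finite_pairs_near {δ : ℝ} (hδ : 0 < δ) (z : ℂ) (T : ℝ) :
    {e : Sym2 (Site 2) | ∀ x ∈ e, dist (meshPoint δ x) z < T}.Finite := by
  have hfin : (meshVertices (ball z T) δ).Finite := meshVertices_finite isBounded_ball hδ
  refine (hfin.toFinset.sym2.finite_toSet).subset fun e he => ?_
  rw [Finset.mem_coe, Finset.mem_sym2_iff]
  intro x hx
  rw [Set.Finite.mem_toFinset]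
  exact mem_ball.2 (he x hx)

/-- The strand families are determined by the pairs inside the ball of radius `R + 2δ`. -/
theorem determinedBy_ufrsStrands_ball {E : DiscreteDobrushin} (hδ : 0 < E.δ) (w : Site 2) (z : ℂ) (k : ℕ)
    {r R : ℝ} (hrR : r < R) :
    DeterminedBy (ufrsStrands E w z k r R) {e : Sym2 (Site 2) | ∀ x ∈ e, dist (meshPoint E.δ x) z < R + 2 * E.δ} :=
  (determinedBy_ufrsStrands E w z k r R hδ hrR).mono fun _ he x hx => (he x hx).2

/-- The strand families are determined by the pairs beyond the radius `r - 2δ`. -/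
theorem determinedBy_ufrsStrands_beyond {E : DiscreteDobrushin} (hδ : 0 < E.δ) (w : Site 2) (z : ℂ) (k : ℕ)
    {r R : ℝ} (hrR : r < R) :
    DeterminedBy (ufrsStrands E w z k r R) {e : Sym2 (Site 2) | ∀ x ∈ e, r - 2 * E.δ < dist (meshPoint E.δ x) z} :=
  (determinedBy_ufrsStrands E w z k r R hδ hrR).mono fun _ he x hx => (he x hx).1

/-- **The strand families are measurable events** (finitely determined, `r < R`). -/
theorem measurableSet_ufrsStrands {E : DiscreteDobrushin} (hδ : 0 < E.δ) (w : Site 2) (z : ℂ) (k : ℕ)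
    {r R : ℝ} (hrR : r < R) : MeasurableSet (ufrsStrands E w z k r R) := by
  have hfin := finite_pairs_near hδ z (R + 2 * E.δ) (δ := E.δ)
  have hdet : DeterminedBy (ufrsStrands E w z k r R) (↑hfin.toFinset : Set (Sym2 (Site 2))) := by
    rw [Set.Finite.coe_toFinset]
    exact determinedBy_ufrsStrands_ball hδ w z k hrR
  exact hdet.measurableSet_of_finset

/-! ## Independence of events read inside a ball and beyond a larger radius -/

/-- **Two slots.** Under `P_{1/2}`, a measurable event determined by the pairs inside the ball of
radius `R₁` around `z` and a measurable event determined by the pairs beyond the radius `r₂ ≥ R₁`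
are independent (disjoint sets of pairs, product measure). -/
theorem real_inter_eq_of_ball_beyond {A B : Set (BondConfig (Site 2))} {δ : ℝ} {z : ℂ} {R₁ r₂ : ℝ}
    (h : R₁ ≤ r₂) (hA : DeterminedBy A {e : Sym2 (Site 2) | ∀ x ∈ e, dist (meshPoint δ x) z < R₁})
    (hB : DeterminedBy B {e : Sym2 (Site 2) | ∀ x ∈ e, r₂ < dist (meshPoint δ x) z})
    (hAm : MeasurableSet A) (hBm : MeasurableSet B) :
    (bondPercolation (zdGraph 2) half).real (A ∩ B) =
      (bondPercolation (zdGraph 2) half).real A * (bondPercolation (zdGraph 2) half).real B := by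
  refine bondPercolation_real_inter_of_disjoint (zdGraph 2) half ?_ hA hB hAm hBm
  rw [Set.disjoint_left]
  intro e h1 h2
  induction e using Sym2.ind with
  | h x y =>
    have hx1 := h1 x (Sym2.mem_mk_left x y)
    have hx2 := h2 x (Sym2.mem_mk_left x y)
    linarith

end

end Summit.CriticalPhenomena.CardyFormulaZ2.Cruxes.EdgePrecompact.QkzStripBoundaryArm
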